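import Literature.Analysis.FluidPDE.FourierL2PicardWeighted
import HarnessLib

/-!
# Differences of Duhamel integrals in the `e^{-λt}`-weighted class

Thirteenth file of the weighted-`L²` Fourier-side construction of the local smooth solution of
the Navier–Stokes system with `H¹`-controlled lifespan (discharge of
`Literature.Analysis.FluidPDE.tao2011_fourier_local_existence`; Tao 2013, Thm. 5.4 (ii)+(iv)).

The convergence of the Picard scheme `v_{n+1} = h - duhamelIntegral c T v_n` is obtained, for
every polynomial weight `(1+‖ξ‖)^K` at once, by the exponential-time-weight method applied to the
differences `D_n = v_n - v_{n+1}`: by bilinearity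

  `duhamelIntegral v - duhamelIntegral v' = ∫₀ᵗ heat(t-s) • (N(v-v', v) + N(v', v-v'))(s) ds`,

and the weight `e^{-λs}` is always routed onto the difference factor, so that only `λ`-free
`L¹ ∩ L²` information on `v, v'` (available uniformly along the iteration:
`FourierL2PicardEnvelope`, `FourierL2PicardWeighted`) and the previous weighted majorant of the
difference enter. This file provides the generic step
(`exp_mul_weight_mul_enorm_duhamelIntegral_sub_le`), its specialisation to `v = h - E`,
`v' = h - E'` with envelopes (`exp_weight_enorm_duhamelIntegral_hsub_sub_le`), and the `L²` and
pointwise bounds of the resulting majorant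
`μ · 3((Q₀ ⋆ₗ G_K) + (Q ⋆ₗ G₀) + (G₀' ⋆ₗ Q) + (G_K ⋆ₗ Q₀))`, `Q₀ = (1+‖·‖)^{-K} Q`
(`lintegral_diff_majorant_sq_le`, `diff_majorant_le`). The induction over `n` is carried out in
`FourierL2PicardCauchy`.

## Wide class (forced twin)

Every theorem of this file taking `hEc : Continuous (uncurry E)` has a primed twin taking instead
`(hEm : Measurable (uncurry E)) (hEt : ∀ η, Continuous fun s => E s η)` — joint measurability and
continuity in time at each frequency, which is all the proofs use of the joint continuity (slice
and joint measurability, dominated convergence in time). This is the class of `E = D - F`, `D`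
jointly continuous, `F = ∫₀ᵗ heat(t-s) • b(s) ds` a forcing term whose Leray-projected coefficient
`b` is discontinuous at `ξ = 0` (forced twin `ForcedFourier*`; Tao 2013, Thm. 5.4 is stated and
proved WITH the force). The unprimed theorems are their specialisations.

## References

* T. Tao, Anal. PDE 6 (2013) = arXiv:1108.1165, proof of Thm. 5.1 (arXiv p. 16: contraction in
  `X¹`; "the estimates for higher `k` follow from variants of the above argument"). [Tao2011]
-/

noncomputable section

open MeasureTheory Real Set Filter Function intervalIntegral
open scoped ENNReal NNReal
open _root_.Topology

namespace Literature.Analysis.FluidPDE.FourierNS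

variable {ι : Type*} [Fintype ι] [DecidableEq ι]

/-! ### The generic weighted step for a difference of Duhamel integrals -/

section DiffStep

variable {v v' : ℝ → EuclideanSpace ℝ ι → ι → ℂ} {c T : ℝ}

/-- **Weighted step for a difference of Duhamel integrals.** Let `v, v'` be `L²`-continuous
trajectories with square-integrable components, `c, λ > 0`, `t ∈ [0, T]`, and write
`M_d(s) = ∑ⱼ‖(v s - v' s)ⱼ‖ₑ`, `M_v`, `M_{v'}` for the real majorants and `w = (1+‖·‖)^K`. If on
`[0, T]`

  `e^{-λs} ((M_d ⋆ₗ wM_v) + (wM_d ⋆ₗ M_v) + (M_{v'} ⋆ₗ wM_d) + (wM_{v'} ⋆ₗ M_d))(ξ) ≤ Y ξ`,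

then `e^{-λt} w(ξ) ‖duhamelIntegral c T v t ξ - duhamelIntegral c T v' t ξ‖ₑ ≤
(2√(cλ))⁻¹ 4π(card ι)² 2^K Y ξ` (bilinearity `N(v,v) - N(v',v') = N(v-v',v) + N(v',v-v')`,
`‖N(p,q)‖ₑ ≤ 4π card² ‖ξ‖ (M_p ⋆ₗ M_q)`, Peetre, and the `L¹_t` kernel gain
`exp_mul_enorm_duhamel_le`). [folklore] -/
theorem exp_mul_weight_mul_enorm_duhamelIntegral_sub_le (hc : 0 < c) {lam : ℝ} (hlam : 0 < lam)
    (hvm : ∀ s, AEStronglyMeasurable (v s) volume) (hv'm : ∀ s, AEStronglyMeasurable (v' s) volume)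
    (hv2 : ∀ s j, MemLp (v s · j) 2 volume) (hv'2 : ∀ s j, MemLp (v' s · j) 2 volume)
    (hvc : ∀ j s₀, Tendsto (fun s => eLpNorm ((v s · j) - (v s₀ · j)) 2 volume) (𝓝 s₀) (𝓝 0))
    (hv'c : ∀ j s₀, Tendsto (fun s => eLpNorm ((v' s · j) - (v' s₀ · j)) 2 volume) (𝓝 s₀) (𝓝 0))
    (K : ℕ) {Y : EuclideanSpace ℝ ι → ℝ≥0∞} (ξ : EuclideanSpace ℝ ι)
    (hY : ∀ s ∈ Icc 0 T, ENNReal.ofReal (Real.exp (-lam * s)) *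
      (((fun η => ∑ j, ‖v s η j - v' s η j‖ₑ) ⋆ₗ
          (fun η => ENNReal.ofReal ((1 + ‖η‖) ^ K) * ∑ j, ‖v s η j‖ₑ)) ξ +
        ((fun η => ENNReal.ofReal ((1 + ‖η‖) ^ K) * ∑ j, ‖v s η j - v' s η j‖ₑ) ⋆ₗ
          (fun η => ∑ j, ‖v s η j‖ₑ)) ξ +
        ((fun η => ∑ j, ‖v' s η j‖ₑ) ⋆ₗ
          (fun η => ENNReal.ofReal ((1 + ‖η‖) ^ K) * ∑ j, ‖v s η j - v' s η j‖ₑ)) ξ +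
        ((fun η => ENNReal.ofReal ((1 + ‖η‖) ^ K) * ∑ j, ‖v' s η j‖ₑ) ⋆ₗ
          (fun η => ∑ j, ‖v s η j - v' s η j‖ₑ)) ξ) ≤ Y ξ)
    {t : ℝ} (ht : t ∈ Icc 0 T) :
    ENNReal.ofReal (Real.exp (-lam * t)) * (ENNReal.ofReal ((1 + ‖ξ‖) ^ K) *
        ‖duhamelIntegral c T v t ξ - duhamelIntegral c T v' t ξ‖ₑ) ≤
      ENNReal.ofReal (1 / (2 * Real.sqrt (c * lam))) * (ENNReal.ofReal (4 * π) *
        (Fintype.card ι : ℝ≥0∞) ^ 2 * 2 ^ K * Y ξ) := by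
  set W : ℝ := (1 + ‖ξ‖) ^ K with hW
  have hW0 : 0 ≤ W := by positivity
  have hpi : ∀ {x : ι → ℂ} {b : ℝ≥0∞}, (∀ l, ‖x l‖ₑ ≤ b) → ‖x‖ₑ ≤ b := by
    intro x b h
    rcases eq_or_ne b ⊤ with hb | hb
    · rw [hb]; exact le_top
    rw [← ofReal_norm, ← ENNReal.ofReal_toReal hb]
    refine ENNReal.ofReal_le_ofReal ((pi_norm_le_iff_of_nonneg ENNReal.toReal_nonneg).2 fun l => ?_)
    rw [← ENNReal.ofReal_le_ofReal_iff ENNReal.toReal_nonneg, ofReal_norm, ENNReal.ofReal_toReal hb]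
    exact h l
  set C : ℝ≥0∞ := ENNReal.ofReal (4 * π) * (Fintype.card ι : ℝ≥0∞) ^ 2 with hC
  -- the three majorants (as explicit functions of `(s, η)`)
  have hMdm : ∀ s, AEMeasurable (fun η => ∑ j, ‖v s η j - v' s η j‖ₑ) volume := fun s => by
    have h := aemeasurable_majorant ((hvm s).sub (hv'm s))
    simpa only [Pi.sub_apply] using h
  have hMvm : ∀ s, AEMeasurable (fun η => ∑ j, ‖v s η j‖ₑ) volume := fun s => aemeasurable_majorant (hvm s)
  have hMv'm : ∀ s, AEMeasurable (fun η => ∑ j, ‖v' s η j‖ₑ) volume := fun s => aemeasurable_majorant (hv'm s)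
  -- the difference of the Duhamel integrals as one integral
  have hint : ∀ {u : ℝ → EuclideanSpace ℝ ι → ι → ℂ}, (∀ s j, MemLp (u s · j) 2 volume) →
      (∀ j s₀, Tendsto (fun s => eLpNorm ((u s · j) - (u s₀ · j)) 2 volume) (𝓝 s₀) (𝓝 0)) →
      IntervalIntegrable (fun s : ℝ => heat c ξ (t - s) • nonlin (u s) (u s) ξ) volume 0 t :=
    fun hu huc => (continuous_duhamel_integrand_time_of_tendsto hu huc t ξ).intervalIntegrable _ _
  have hdiff : duhamelIntegral c T v t ξ - duhamelIntegral c T v' t ξ =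
      ∫ s in (0 : ℝ)..t, heat c ξ (t - s) • (nonlin (v s) (v s) ξ - nonlin (v' s) (v' s) ξ) := by
    unfold duhamelIntegral
    rw [clamp_of_mem ht, ← intervalIntegral.integral_sub (hint hv2 hvc) (hint hv'2 hv'c)]
    refine intervalIntegral.integral_congr fun s _ => ?_
    simp only [smul_sub]
  -- the rescaled integrand
  set N' : ℝ → (ι → ℂ) := fun s => W • (nonlin (v s) (v s) ξ - nonlin (v' s) (v' s) ξ) with hN'
  have hscale : ∫ s in (0 : ℝ)..t, heat c ξ (t - s) • N' s =
      W • ∫ s in (0 : ℝ)..t, heat c ξ (t - s) • (nonlin (v s) (v s) ξ - nonlin (v' s) (v' s) ξ) := by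
    rw [← intervalIntegral.integral_smul]
    refine intervalIntegral.integral_congr fun s _ => ?_
    simp only [hN']
    rw [smul_comm]
  have hnormint : ‖∫ s in (0 : ℝ)..t, heat c ξ (t - s) • N' s‖ₑ =
      ENNReal.ofReal W * ‖duhamelIntegral c T v t ξ - duhamelIntegral c T v' t ξ‖ₑ := by
    rw [hscale, enorm_smul, Real.enorm_eq_ofReal hW0, hdiff]
  -- the bound of the integrand through the two majorant products
  set φ : ℝ → ℝ≥0∞ := fun s => ENNReal.ofReal W * (C *
    (((fun η => ∑ j, ‖v s η j - v' s η j‖ₑ) ⋆ₗ (fun η => ∑ j, ‖v s η j‖ₑ)) ξ +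
      ((fun η => ∑ j, ‖v' s η j‖ₑ) ⋆ₗ (fun η => ∑ j, ‖v s η j - v' s η j‖ₑ)) ξ)) with hφ
  have hN : ∀ s ∈ Icc 0 T, ‖N' s‖ₑ ≤ ENNReal.ofReal ‖ξ‖ * φ s := by
    intro s _
    rw [hN', enorm_smul, Real.enorm_eq_ofReal hW0, hφ]
    have hsplit : nonlin (v s) (v s) ξ - nonlin (v' s) (v' s) ξ =
        nonlin (v s - v' s) (v s) ξ + nonlin (v' s) (v s - v' s) ξ :=
      nonlin_self_sub_self_of_memLp (hv2 s) (hv'2 s) ξ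
    have h1 : ‖nonlin (v s - v' s) (v s) ξ‖ₑ ≤ ENNReal.ofReal ‖ξ‖ *
        (C * ((fun η => ∑ j, ‖v s η j - v' s η j‖ₑ) ⋆ₗ (fun η => ∑ j, ‖v s η j‖ₑ)) ξ) := by
      refine hpi fun l => ?_
      calc ‖nonlin (v s - v' s) (v s) ξ l‖ₑ ≤ _ := enorm_nonlin_apply_le (v s - v' s) (v s) ξ l
        _ = _ := by rw [hC]; simp only [Pi.sub_apply]; ring
    have h2 : ‖nonlin (v' s) (v s - v' s) ξ‖ₑ ≤ ENNReal.ofReal ‖ξ‖ *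
        (C * ((fun η => ∑ j, ‖v' s η j‖ₑ) ⋆ₗ (fun η => ∑ j, ‖v s η j - v' s η j‖ₑ)) ξ) := by
      refine hpi fun l => ?_
      calc ‖nonlin (v' s) (v s - v' s) ξ l‖ₑ ≤ _ := enorm_nonlin_apply_le (v' s) (v s - v' s) ξ l
        _ = _ := by rw [hC]; simp only [Pi.sub_apply]; ring
    calc ENNReal.ofReal W * ‖nonlin (v s) (v s) ξ - nonlin (v' s) (v' s) ξ‖ₑ
        ≤ ENNReal.ofReal W * (ENNReal.ofReal ‖ξ‖ *
            (C * ((fun η => ∑ j, ‖v s η j - v' s η j‖ₑ) ⋆ₗ (fun η => ∑ j, ‖v s η j‖ₑ)) ξ) +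
            ENNReal.ofReal ‖ξ‖ *
            (C * ((fun η => ∑ j, ‖v' s η j‖ₑ) ⋆ₗ (fun η => ∑ j, ‖v s η j - v' s η j‖ₑ)) ξ)) := by
          rw [hsplit]
          exact mul_le_mul' le_rfl ((enorm_add_le _ _).trans (add_le_add h1 h2))
      _ = _ := by ring
  have hΦ : ∀ s ∈ Icc 0 T, ENNReal.ofReal (Real.exp (-lam * s)) * φ s ≤ C * 2 ^ K * Y ξ := by
    intro s hs
    -- Peetre on the two products
    have hp1 : ENNReal.ofReal W * ((fun η => ∑ j, ‖v s η j - v' s η j‖ₑ) ⋆ₗ (fun η => ∑ j, ‖v s η j‖ₑ)) ξ ≤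
        2 ^ K * (((fun η => ∑ j, ‖v s η j - v' s η j‖ₑ) ⋆ₗ
            (fun η => ENNReal.ofReal ((1 + ‖η‖) ^ K) * ∑ j, ‖v s η j‖ₑ)) ξ +
          ((fun η => ENNReal.ofReal ((1 + ‖η‖) ^ K) * ∑ j, ‖v s η j - v' s η j‖ₑ) ⋆ₗ
            (fun η => ∑ j, ‖v s η j‖ₑ)) ξ) :=
      weight_mul_lconv_le (hMdm s) (hMvm s) K ξ
    have hp2 : ENNReal.ofReal W * ((fun η => ∑ j, ‖v' s η j‖ₑ) ⋆ₗ (fun η => ∑ j, ‖v s η j - v' s η j‖ₑ)) ξ ≤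
        2 ^ K * (((fun η => ∑ j, ‖v' s η j‖ₑ) ⋆ₗ
            (fun η => ENNReal.ofReal ((1 + ‖η‖) ^ K) * ∑ j, ‖v s η j - v' s η j‖ₑ)) ξ +
          ((fun η => ENNReal.ofReal ((1 + ‖η‖) ^ K) * ∑ j, ‖v' s η j‖ₑ) ⋆ₗ
            (fun η => ∑ j, ‖v s η j - v' s η j‖ₑ)) ξ) :=
      weight_mul_lconv_le (hMv'm s) (hMdm s) K ξ
    have hY' := hY s hs
    -- name the four products
    set A1 := ((fun η => ∑ j, ‖v s η j - v' s η j‖ₑ) ⋆ₗ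
      (fun η => ENNReal.ofReal ((1 + ‖η‖) ^ K) * ∑ j, ‖v s η j‖ₑ)) ξ with hA1
    set A2 := ((fun η => ENNReal.ofReal ((1 + ‖η‖) ^ K) * ∑ j, ‖v s η j - v' s η j‖ₑ) ⋆ₗ
      (fun η => ∑ j, ‖v s η j‖ₑ)) ξ with hA2
    set A3 := ((fun η => ∑ j, ‖v' s η j‖ₑ) ⋆ₗ
      (fun η => ENNReal.ofReal ((1 + ‖η‖) ^ K) * ∑ j, ‖v s η j - v' s η j‖ₑ)) ξ with hA3
    set A4 := ((fun η => ENNReal.ofReal ((1 + ‖η‖) ^ K) * ∑ j, ‖v' s η j‖ₑ) ⋆ₗ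
      (fun η => ∑ j, ‖v s η j - v' s η j‖ₑ)) ξ with hA4
    set B1 := ((fun η => ∑ j, ‖v s η j - v' s η j‖ₑ) ⋆ₗ (fun η => ∑ j, ‖v s η j‖ₑ)) ξ with hB1
    set B2 := ((fun η => ∑ j, ‖v' s η j‖ₑ) ⋆ₗ (fun η => ∑ j, ‖v s η j - v' s η j‖ₑ)) ξ with hB2
    set e := ENNReal.ofReal (Real.exp (-lam * s)) with he
    have hsum : ENNReal.ofReal W * (B1 + B2) ≤ 2 ^ K * (A1 + A2 + A3 + A4) := by
      rw [mul_add]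
      refine (add_le_add hp1 hp2).trans (le_of_eq ?_)
      ring
    calc e * φ s = C * (e * (ENNReal.ofReal W * (B1 + B2))) := by rw [hφ]; ring
      _ ≤ C * (e * (2 ^ K * (A1 + A2 + A3 + A4))) := mul_le_mul' le_rfl (mul_le_mul' le_rfl hsum)
      _ = C * 2 ^ K * (e * (A1 + A2 + A3 + A4)) := by ring
      _ ≤ C * 2 ^ K * Y ξ := mul_le_mul' le_rfl hY'
  have h := exp_mul_enorm_duhamel_le (N := N') (ξ := ξ) hc hlam hN hΦ ht
  rw [hnormint] at h
  calc ENNReal.ofReal (Real.exp (-lam * t)) * (ENNReal.ofReal ((1 + ‖ξ‖) ^ K) *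
        ‖duhamelIntegral c T v t ξ - duhamelIntegral c T v' t ξ‖ₑ)
      ≤ ENNReal.ofReal (1 / (2 * Real.sqrt (c * lam))) * (C * 2 ^ K * Y ξ) := h
    _ = _ := by rw [hC]

end DiffStep

/-! ### The step for `v = h - E`, `v' = h - E'` with envelopes (dimension three) -/

section HsubStep

variable {c T : ℝ} {a : EuclideanSpace ℝ (Fin 3) → Fin 3 → ℂ}
  {E E' : ℝ → EuclideanSpace ℝ (Fin 3) → Fin 3 → ℂ}

/-- `‖x - y‖ₑ = ‖y - x‖ₑ`. [folklore] -/
theorem enorm_sub_comm {F : Type*} [NormedAddCommGroup F] (x y : F) : ‖x - y‖ₑ = ‖y - x‖ₑ := by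
  rw [← ofReal_norm, norm_sub_rev, ofReal_norm]

/-- **Weighted difference step with envelopes.** Let `v = h - E`, `v' = h - E'` with `E, E'`
jointly continuous, `c, λ > 0`, `t ∈ [0, T]`, and suppose on `[0, T]`: `‖E(s,η)‖ₑ ≤ Ψ(η)`,
`‖E'(s,η)‖ₑ ≤ Ψ'(η)`, `(1+‖η‖)^{K+2}‖E(s,η)‖ₑ ≤ b`, `(1+‖η‖)^{K+2}‖E'(s,η)‖ₑ ≤ b`, and the weighted
envelope of the difference `e^{-λs}(1+‖η‖)^K ‖E(s,η) - E'(s,η)‖ₑ ≤ Q(η)`. Then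

  `e^{-λt}(1+‖ξ‖)^K ‖duhamelIntegral v (t,ξ) - duhamelIntegral v' (t,ξ)‖ₑ
     ≤ (2√(cλ))⁻¹ C_N 2^K · 3 ((Q₀ ⋆ₗ G_K) + (Q ⋆ₗ G₀) + (G₀' ⋆ₗ Q) + (G_K ⋆ₗ Q₀))(ξ)`,

`Q₀ = (1+‖·‖)^{-K}Q`, `G₀ = ∑ⱼ‖aⱼ‖ₑ + 3Ψ`, `G₀' = ∑ⱼ‖aⱼ‖ₑ + 3Ψ'`,
`G_K = (1+‖·‖)^K∑ⱼ‖aⱼ‖ₑ + 3b(1+‖·‖)^{-2}` — the exponential weight always rides on the difference.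
[cite: Tao2011, Thm. 5.4 (ii) WITH force (arXiv:1108.1165 Thm. 31 (ii), p. 18);
proof of Thm. 5.1 (arXiv Thm. 28, p. 16); Lemma 2.1 = arXiv Lemma 23] -/
theorem exp_weight_enorm_duhamelIntegral_hsub_sub_le' (hc : 0 < c) (ha : AEStronglyMeasurable a volume)
    (haw : ∀ (k : ℕ) j, ∫⁻ η, (ENNReal.ofReal ((1 + ‖η‖) ^ k) * ‖a η j‖ₑ) ^ 2 < ⊤)
    (hEm : Measurable (uncurry E)) (hEt : ∀ η, Continuous fun s => E s η)
    (hEd : ∀ K : ℕ, ∃ B : ℝ, ∀ t, HasDecay K B (E t))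
    (hE'm : Measurable (uncurry E')) (hE't : ∀ η, Continuous fun s => E' s η)
    (hE'd : ∀ K : ℕ, ∃ B : ℝ, ∀ t, HasDecay K B (E' t))
    (K : ℕ) {lam : ℝ} (hlam : 0 < lam)
    {Ψ Ψ' Q : EuclideanSpace ℝ (Fin 3) → ℝ≥0∞} {b : ℝ≥0∞}
    (hΨ : ∀ s ∈ Icc 0 T, ∀ η, ‖E s η‖ₑ ≤ Ψ η) (hΨ' : ∀ s ∈ Icc 0 T, ∀ η, ‖E' s η‖ₑ ≤ Ψ' η)
    (hB : ∀ s ∈ Icc 0 T, ∀ η, ENNReal.ofReal ((1 + ‖η‖) ^ (K + 2)) * ‖E s η‖ₑ ≤ b)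
    (hB' : ∀ s ∈ Icc 0 T, ∀ η, ENNReal.ofReal ((1 + ‖η‖) ^ (K + 2)) * ‖E' s η‖ₑ ≤ b)
    (hQ : ∀ s ∈ Icc 0 T, ∀ η, ENNReal.ofReal (Real.exp (-lam * s) * (1 + ‖η‖) ^ K) *
      ‖E s η - E' s η‖ₑ ≤ Q η)
    {t : ℝ} (ht : t ∈ Icc 0 T) (ξ : EuclideanSpace ℝ (Fin 3)) :
    ENNReal.ofReal (Real.exp (-lam * t) * (1 + ‖ξ‖) ^ K) *
        ‖duhamelIntegral c T (fun s ζ => heat c ζ (clamp T s) • a ζ - E s ζ) t ξ -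
          duhamelIntegral c T (fun s ζ => heat c ζ (clamp T s) • a ζ - E' s ζ) t ξ‖ₑ ≤
      ENNReal.ofReal (1 / (2 * Real.sqrt (c * lam))) * (ENNReal.ofReal (4 * π) *
        (Fintype.card (Fin 3) : ℝ≥0∞) ^ 2 * 2 ^ K * (3 *
        (((fun η => (ENNReal.ofReal ((1 + ‖η‖) ^ K))⁻¹ * Q η) ⋆ₗ
            (fun η => ENNReal.ofReal ((1 + ‖η‖) ^ K) * (∑ j, ‖a η j‖ₑ) +
              3 * (b * (ENNReal.ofReal ((1 + ‖η‖) ^ 2))⁻¹))) ξ +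
          (Q ⋆ₗ (fun η => (∑ j, ‖a η j‖ₑ) + 3 * Ψ η)) ξ +
          ((fun η => (∑ j, ‖a η j‖ₑ) + 3 * Ψ' η) ⋆ₗ Q) ξ +
          ((fun η => ENNReal.ofReal ((1 + ‖η‖) ^ K) * (∑ j, ‖a η j‖ₑ) +
              3 * (b * (ENNReal.ofReal ((1 + ‖η‖) ^ 2))⁻¹)) ⋆ₗ
            (fun η => (ENNReal.ofReal ((1 + ‖η‖) ^ K))⁻¹ * Q η)) ξ))) := by
  set v : ℝ → EuclideanSpace ℝ (Fin 3) → Fin 3 → ℂ := fun s ζ => heat c ζ (clamp T s) • a ζ - E s ζ with hv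
  set v' : ℝ → EuclideanSpace ℝ (Fin 3) → Fin 3 → ℂ := fun s ζ => heat c ζ (clamp T s) • a ζ - E' s ζ with hv'
  -- trajectory packages
  set m₀ := Module.finrank ℝ (EuclideanSpace ℝ (Fin 3)) + 1 with hm₀
  have hm₀lt : Module.finrank ℝ (EuclideanSpace ℝ (Fin 3)) < 2 * m₀ := finrank_lt_two_mul_succ
  have ha2 : ∀ j, ∫⁻ η, ‖a η j‖ₑ ^ 2 < ⊤ := fun j => by simpa using haw 0 j
  obtain ⟨B₀, hB₀⟩ := hEd m₀
  obtain ⟨B₀', hB₀'⟩ := hE'd m₀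
  have hvm : ∀ s, AEStronglyMeasurable (v s) volume := aestronglyMeasurable_hsub_slice' c T a E ha hEm
  have hv'm : ∀ s, AEStronglyMeasurable (v' s) volume := aestronglyMeasurable_hsub_slice' c T a E' ha hE'm
  have hv2 : ∀ s j, MemLp (v s · j) 2 volume := memLp_hsub_apply' c T a E hc.le ha ha2 hEm hm₀lt hB₀
  have hv'2 : ∀ s j, MemLp (v' s · j) 2 volume := memLp_hsub_apply' c T a E' hc.le ha ha2 hE'm hm₀lt hB₀'
  have hvc : ∀ j s₀, Tendsto (fun s => eLpNorm ((v s · j) - (v s₀ · j)) 2 volume) (𝓝 s₀) (𝓝 0) :=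
    tendsto_eLpNorm_hsub_apply' c T a E hc.le ha ha2 hEm hEt hm₀lt hB₀
  have hv'c : ∀ j s₀, Tendsto (fun s => eLpNorm ((v' s · j) - (v' s₀ · j)) 2 volume) (𝓝 s₀) (𝓝 0) :=
    tendsto_eLpNorm_hsub_apply' c T a E' hc.le ha ha2 hE'm hE't hm₀lt hB₀'
  have h3 : (Fintype.card (Fin 3) : ℝ≥0∞) = 3 := by simp
  -- abbreviations for the envelopes
  set Amaj : EuclideanSpace ℝ (Fin 3) → ℝ≥0∞ := fun η => ∑ j, ‖a η j‖ₑ with hAmaj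
  set Q₀ : EuclideanSpace ℝ (Fin 3) → ℝ≥0∞ := fun η => (ENNReal.ofReal ((1 + ‖η‖) ^ K))⁻¹ * Q η with hQ₀
  set GK : EuclideanSpace ℝ (Fin 3) → ℝ≥0∞ :=
    fun η => ENNReal.ofReal ((1 + ‖η‖) ^ K) * Amaj η + 3 * (b * (ENNReal.ofReal ((1 + ‖η‖) ^ 2))⁻¹) with hGK
  set G₀ : EuclideanSpace ℝ (Fin 3) → ℝ≥0∞ := fun η => Amaj η + 3 * Ψ η with hG₀
  set G₀' : EuclideanSpace ℝ (Fin 3) → ℝ≥0∞ := fun η => Amaj η + 3 * Ψ' η with hG₀'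
  have hwpos : ∀ η : EuclideanSpace ℝ (Fin 3), ENNReal.ofReal ((1 + ‖η‖) ^ K) ≠ 0 := fun η =>
    (lt_of_lt_of_le zero_lt_one (one_le_ofReal_weight K η)).ne'
  have hw2pos : ∀ η : EuclideanSpace ℝ (Fin 3), ENNReal.ofReal ((1 + ‖η‖) ^ 2) ≠ 0 := fun η =>
    (lt_of_lt_of_le zero_lt_one (one_le_ofReal_weight 2 η)).ne'
  -- pointwise envelope inequalities on `[0, T]`
  have hMd : ∀ s η, (∑ j, ‖v s η j - v' s η j‖ₑ) ≤ 3 * ‖E s η - E' s η‖ₑ := by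
    intro s η
    have hcomp : ∀ j, v s η j - v' s η j = (E' s η - E s η) j := fun j => by
      simp only [hv, hv', Pi.sub_apply]; ring
    simp_rw [hcomp]
    calc (∑ j, ‖(E' s η - E s η) j‖ₑ) ≤ 3 * ‖E' s η - E s η‖ₑ := by
          simpa only [h3] using majorant_le_card_mul_enorm (E' s η - E s η)
      _ = 3 * ‖E s η - E' s η‖ₑ := by rw [enorm_sub_comm]
  have hMv : ∀ {F : ℝ → EuclideanSpace ℝ (Fin 3) → Fin 3 → ℂ} (s : ℝ) (η : EuclideanSpace ℝ (Fin 3)),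
      (∑ j, ‖(heat c η (clamp T s) • a η - F s η) j‖ₑ) ≤ Amaj η + 3 * ‖F s η‖ₑ := by
    intro F s η
    calc (∑ j, ‖(heat c η (clamp T s) • a η - F s η) j‖ₑ) ≤ (∑ j, ‖a η j‖ₑ) + ∑ j, ‖F s η j‖ₑ := by
          rw [← Finset.sum_add_distrib]
          refine Finset.sum_le_sum fun j _ => ?_
          rw [Pi.sub_apply]
          exact (enorm_sub_le).trans (add_le_add (enorm_heat_smul_apply_le hc.le s η j) le_rfl)
      _ ≤ Amaj η + 3 * ‖F s η‖ₑ := add_le_add le_rfl (by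
          simpa only [h3] using majorant_le_card_mul_enorm (F s η))
  -- (i) the `λ`-free unweighted majorants
  have hG₀v : ∀ s ∈ Icc 0 T, ∀ η, (∑ j, ‖v s η j‖ₑ) ≤ G₀ η := fun s hs η =>
    (hMv (F := E) s η).trans (add_le_add le_rfl (mul_le_mul' le_rfl (hΨ s hs η)))
  have hG₀v' : ∀ s ∈ Icc 0 T, ∀ η, (∑ j, ‖v' s η j‖ₑ) ≤ G₀' η := fun s hs η =>
    (hMv (F := E') s η).trans (add_le_add le_rfl (mul_le_mul' le_rfl (hΨ' s hs η)))
  -- (ii) the `λ`-free weighted majorants through the decay of order `K + 2`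
  have hGKF : ∀ {F : ℝ → EuclideanSpace ℝ (Fin 3) → Fin 3 → ℂ},
      (∀ s ∈ Icc 0 T, ∀ η, ENNReal.ofReal ((1 + ‖η‖) ^ (K + 2)) * ‖F s η‖ₑ ≤ b) →
      ∀ s ∈ Icc 0 T, ∀ η, ENNReal.ofReal ((1 + ‖η‖) ^ K) *
        (∑ j, ‖(heat c η (clamp T s) • a η - F s η) j‖ₑ) ≤ GK η := by
    intro F hF s hs η
    have hdec : ENNReal.ofReal ((1 + ‖η‖) ^ K) * ‖F s η‖ₑ ≤ b * (ENNReal.ofReal ((1 + ‖η‖) ^ 2))⁻¹ := by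
      have hsplit : ENNReal.ofReal ((1 + ‖η‖) ^ (K + 2)) =
          ENNReal.ofReal ((1 + ‖η‖) ^ K) * ENNReal.ofReal ((1 + ‖η‖) ^ 2) := by
        rw [pow_add, ENNReal.ofReal_mul (by positivity)]
      have h1 := hF s hs η
      rw [hsplit] at h1
      calc ENNReal.ofReal ((1 + ‖η‖) ^ K) * ‖F s η‖ₑ = (ENNReal.ofReal ((1 + ‖η‖) ^ 2))⁻¹ *
            (ENNReal.ofReal ((1 + ‖η‖) ^ 2) * (ENNReal.ofReal ((1 + ‖η‖) ^ K) * ‖F s η‖ₑ)) := by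
            rw [← mul_assoc, ENNReal.inv_mul_cancel (hw2pos η) ENNReal.ofReal_ne_top, one_mul]
        _ = (ENNReal.ofReal ((1 + ‖η‖) ^ 2))⁻¹ *
            (ENNReal.ofReal ((1 + ‖η‖) ^ K) * ENNReal.ofReal ((1 + ‖η‖) ^ 2) * ‖F s η‖ₑ) := by ring
        _ ≤ (ENNReal.ofReal ((1 + ‖η‖) ^ 2))⁻¹ * b := mul_le_mul' le_rfl h1
        _ = _ := mul_comm _ _
    calc ENNReal.ofReal ((1 + ‖η‖) ^ K) * (∑ j, ‖(heat c η (clamp T s) • a η - F s η) j‖ₑ)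
        ≤ ENNReal.ofReal ((1 + ‖η‖) ^ K) * (Amaj η + 3 * ‖F s η‖ₑ) := mul_le_mul' le_rfl (hMv s η)
      _ = ENNReal.ofReal ((1 + ‖η‖) ^ K) * Amaj η + 3 * (ENNReal.ofReal ((1 + ‖η‖) ^ K) * ‖F s η‖ₑ) := by
          ring
      _ ≤ GK η := add_le_add le_rfl (mul_le_mul' le_rfl hdec)
  have hGKv := hGKF (F := E) hB
  have hGKv' := hGKF (F := E') hB'
  -- (iii) the weighted majorants of the difference
  have hQd : ∀ s ∈ Icc 0 T, ∀ η, ENNReal.ofReal (Real.exp (-lam * s)) *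
      (ENNReal.ofReal ((1 + ‖η‖) ^ K) * ∑ j, ‖v s η j - v' s η j‖ₑ) ≤ 3 * Q η := by
    intro s hs η
    calc ENNReal.ofReal (Real.exp (-lam * s)) * (ENNReal.ofReal ((1 + ‖η‖) ^ K) * ∑ j, ‖v s η j - v' s η j‖ₑ)
        ≤ ENNReal.ofReal (Real.exp (-lam * s)) * (ENNReal.ofReal ((1 + ‖η‖) ^ K) * (3 * ‖E s η - E' s η‖ₑ)) :=
          mul_le_mul' le_rfl (mul_le_mul' le_rfl (hMd s η))
      _ = 3 * (ENNReal.ofReal (Real.exp (-lam * s) * (1 + ‖η‖) ^ K) * ‖E s η - E' s η‖ₑ) := by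
          rw [ENNReal.ofReal_mul (Real.exp_pos _).le]; ring
      _ ≤ 3 * Q η := mul_le_mul' le_rfl (hQ s hs η)
  have hQ₀d : ∀ s ∈ Icc 0 T, ∀ η, ENNReal.ofReal (Real.exp (-lam * s)) *
      (∑ j, ‖v s η j - v' s η j‖ₑ) ≤ 3 * Q₀ η := by
    intro s hs η
    calc ENNReal.ofReal (Real.exp (-lam * s)) * (∑ j, ‖v s η j - v' s η j‖ₑ)
        = (ENNReal.ofReal ((1 + ‖η‖) ^ K))⁻¹ * (ENNReal.ofReal (Real.exp (-lam * s)) *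
            (ENNReal.ofReal ((1 + ‖η‖) ^ K) * ∑ j, ‖v s η j - v' s η j‖ₑ)) := by
          rw [← mul_assoc, mul_comm ((ENNReal.ofReal ((1 + ‖η‖) ^ K))⁻¹), mul_assoc,
            ← mul_assoc ((ENNReal.ofReal ((1 + ‖η‖) ^ K))⁻¹),
            ENNReal.inv_mul_cancel (hwpos η) ENNReal.ofReal_ne_top, one_mul]
      _ ≤ (ENNReal.ofReal ((1 + ‖η‖) ^ K))⁻¹ * (3 * Q η) := mul_le_mul' le_rfl (hQd s hs η)
      _ = 3 * Q₀ η := by rw [hQ₀]; ring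
  -- the combined hypothesis of the generic step
  have hY : ∀ s ∈ Icc 0 T, ENNReal.ofReal (Real.exp (-lam * s)) *
      (((fun η => ∑ j, ‖v s η j - v' s η j‖ₑ) ⋆ₗ (fun η => ENNReal.ofReal ((1 + ‖η‖) ^ K) * ∑ j, ‖v s η j‖ₑ)) ξ +
        ((fun η => ENNReal.ofReal ((1 + ‖η‖) ^ K) * ∑ j, ‖v s η j - v' s η j‖ₑ) ⋆ₗ (fun η => ∑ j, ‖v s η j‖ₑ)) ξ +
        ((fun η => ∑ j, ‖v' s η j‖ₑ) ⋆ₗ (fun η => ENNReal.ofReal ((1 + ‖η‖) ^ K) * ∑ j, ‖v s η j - v' s η j‖ₑ)) ξ +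
        ((fun η => ENNReal.ofReal ((1 + ‖η‖) ^ K) * ∑ j, ‖v' s η j‖ₑ) ⋆ₗ (fun η => ∑ j, ‖v s η j - v' s η j‖ₑ)) ξ) ≤
      3 * ((Q₀ ⋆ₗ GK) ξ + (Q ⋆ₗ G₀) ξ + (G₀' ⋆ₗ Q) ξ + (GK ⋆ₗ Q₀) ξ) := by
    intro s hs
    set e := ENNReal.ofReal (Real.exp (-lam * s)) with he
    have hetop : e ≠ ⊤ := ENNReal.ofReal_ne_top
    have h1 : e * ((fun η => ∑ j, ‖v s η j - v' s η j‖ₑ) ⋆ₗ (fun η => ENNReal.ofReal ((1 + ‖η‖) ^ K) * ∑ j, ‖v s η j‖ₑ)) ξ ≤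
        3 * (Q₀ ⋆ₗ GK) ξ := by
      rw [← lconv_const_mul_left _ hetop, ← lconv_const_mul_left _ (by norm_num)]
      exact lconv_mono (fun η => hQ₀d s hs η) (fun η => hGKv s hs η) ξ
    have h2 : e * ((fun η => ENNReal.ofReal ((1 + ‖η‖) ^ K) * ∑ j, ‖v s η j - v' s η j‖ₑ) ⋆ₗ (fun η => ∑ j, ‖v s η j‖ₑ)) ξ ≤
        3 * (Q ⋆ₗ G₀) ξ := by
      rw [← lconv_const_mul_left _ hetop, ← lconv_const_mul_left _ (by norm_num)]
      exact lconv_mono (fun η => hQd s hs η) (fun η => hG₀v s hs η) ξ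
    have h3' : e * ((fun η => ∑ j, ‖v' s η j‖ₑ) ⋆ₗ (fun η => ENNReal.ofReal ((1 + ‖η‖) ^ K) * ∑ j, ‖v s η j - v' s η j‖ₑ)) ξ ≤
        3 * (G₀' ⋆ₗ Q) ξ := by
      rw [← lconv_const_mul_right _ hetop, ← lconv_const_mul_right _ (by norm_num)]
      exact lconv_mono (fun η => hG₀v' s hs η) (fun η => hQd s hs η) ξ
    have h4 : e * ((fun η => ENNReal.ofReal ((1 + ‖η‖) ^ K) * ∑ j, ‖v' s η j‖ₑ) ⋆ₗ (fun η => ∑ j, ‖v s η j - v' s η j‖ₑ)) ξ ≤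
        3 * (GK ⋆ₗ Q₀) ξ := by
      rw [← lconv_const_mul_right _ hetop, ← lconv_const_mul_right _ (by norm_num)]
      exact lconv_mono (fun η => hGKv' s hs η) (fun η => hQ₀d s hs η) ξ
    calc _ = e * ((fun η => ∑ j, ‖v s η j - v' s η j‖ₑ) ⋆ₗ (fun η => ENNReal.ofReal ((1 + ‖η‖) ^ K) * ∑ j, ‖v s η j‖ₑ)) ξ +
          e * ((fun η => ENNReal.ofReal ((1 + ‖η‖) ^ K) * ∑ j, ‖v s η j - v' s η j‖ₑ) ⋆ₗ (fun η => ∑ j, ‖v s η j‖ₑ)) ξ +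
          e * ((fun η => ∑ j, ‖v' s η j‖ₑ) ⋆ₗ (fun η => ENNReal.ofReal ((1 + ‖η‖) ^ K) * ∑ j, ‖v s η j - v' s η j‖ₑ)) ξ +
          e * ((fun η => ENNReal.ofReal ((1 + ‖η‖) ^ K) * ∑ j, ‖v' s η j‖ₑ) ⋆ₗ (fun η => ∑ j, ‖v s η j - v' s η j‖ₑ)) ξ := by
          ring
      _ ≤ 3 * (Q₀ ⋆ₗ GK) ξ + 3 * (Q ⋆ₗ G₀) ξ + 3 * (G₀' ⋆ₗ Q) ξ + 3 * (GK ⋆ₗ Q₀) ξ :=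
          add_le_add (add_le_add (add_le_add h1 h2) h3') h4
      _ = _ := by ring
  have h := exp_mul_weight_mul_enorm_duhamelIntegral_sub_le (T := T) hc hlam hvm hv'm hv2 hv'2 hvc hv'c
    K (Y := fun ζ => 3 * ((Q₀ ⋆ₗ GK) ζ + (Q ⋆ₗ G₀) ζ + (G₀' ⋆ₗ Q) ζ + (GK ⋆ₗ Q₀) ζ)) ξ hY ht
  rw [ENNReal.ofReal_mul (Real.exp_pos _).le, mul_assoc]
  exact h

/-- **Weighted difference step with envelopes.** Let `v = h - E`, `v' = h - E'` with `E, E'`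
jointly continuous, `c, λ > 0`, `t ∈ [0, T]`, and suppose on `[0, T]`: `‖E(s,η)‖ₑ ≤ Ψ(η)`,
`‖E'(s,η)‖ₑ ≤ Ψ'(η)`, `(1+‖η‖)^{K+2}‖E(s,η)‖ₑ ≤ b`, `(1+‖η‖)^{K+2}‖E'(s,η)‖ₑ ≤ b`, and the weighted
envelope of the difference `e^{-λs}(1+‖η‖)^K ‖E(s,η) - E'(s,η)‖ₑ ≤ Q(η)`. Then

  `e^{-λt}(1+‖ξ‖)^K ‖duhamelIntegral v (t,ξ) - duhamelIntegral v' (t,ξ)‖ₑ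
     ≤ (2√(cλ))⁻¹ C_N 2^K · 3 ((Q₀ ⋆ₗ G_K) + (Q ⋆ₗ G₀) + (G₀' ⋆ₗ Q) + (G_K ⋆ₗ Q₀))(ξ)`,

`Q₀ = (1+‖·‖)^{-K}Q`, `G₀ = ∑ⱼ‖aⱼ‖ₑ + 3Ψ`, `G₀' = ∑ⱼ‖aⱼ‖ₑ + 3Ψ'`,
`G_K = (1+‖·‖)^K∑ⱼ‖aⱼ‖ₑ + 3b(1+‖·‖)^{-2}` — the exponential weight always rides on the difference.
[folklore] -/
theorem exp_weight_enorm_duhamelIntegral_hsub_sub_le (hc : 0 < c) (ha : AEStronglyMeasurable a volume)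
    (haw : ∀ (k : ℕ) j, ∫⁻ η, (ENNReal.ofReal ((1 + ‖η‖) ^ k) * ‖a η j‖ₑ) ^ 2 < ⊤)
    (hEc : Continuous (uncurry E)) (hEd : ∀ K : ℕ, ∃ B : ℝ, ∀ t, HasDecay K B (E t))
    (hE'c : Continuous (uncurry E')) (hE'd : ∀ K : ℕ, ∃ B : ℝ, ∀ t, HasDecay K B (E' t))
    (K : ℕ) {lam : ℝ} (hlam : 0 < lam)
    {Ψ Ψ' Q : EuclideanSpace ℝ (Fin 3) → ℝ≥0∞} {b : ℝ≥0∞}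
    (hΨ : ∀ s ∈ Icc 0 T, ∀ η, ‖E s η‖ₑ ≤ Ψ η) (hΨ' : ∀ s ∈ Icc 0 T, ∀ η, ‖E' s η‖ₑ ≤ Ψ' η)
    (hB : ∀ s ∈ Icc 0 T, ∀ η, ENNReal.ofReal ((1 + ‖η‖) ^ (K + 2)) * ‖E s η‖ₑ ≤ b)
    (hB' : ∀ s ∈ Icc 0 T, ∀ η, ENNReal.ofReal ((1 + ‖η‖) ^ (K + 2)) * ‖E' s η‖ₑ ≤ b)
    (hQ : ∀ s ∈ Icc 0 T, ∀ η, ENNReal.ofReal (Real.exp (-lam * s) * (1 + ‖η‖) ^ K) *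
      ‖E s η - E' s η‖ₑ ≤ Q η)
    {t : ℝ} (ht : t ∈ Icc 0 T) (ξ : EuclideanSpace ℝ (Fin 3)) :
    ENNReal.ofReal (Real.exp (-lam * t) * (1 + ‖ξ‖) ^ K) *
        ‖duhamelIntegral c T (fun s ζ => heat c ζ (clamp T s) • a ζ - E s ζ) t ξ -
          duhamelIntegral c T (fun s ζ => heat c ζ (clamp T s) • a ζ - E' s ζ) t ξ‖ₑ ≤
      ENNReal.ofReal (1 / (2 * Real.sqrt (c * lam))) * (ENNReal.ofReal (4 * π) *
        (Fintype.card (Fin 3) : ℝ≥0∞) ^ 2 * 2 ^ K * (3 *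
        (((fun η => (ENNReal.ofReal ((1 + ‖η‖) ^ K))⁻¹ * Q η) ⋆ₗ
            (fun η => ENNReal.ofReal ((1 + ‖η‖) ^ K) * (∑ j, ‖a η j‖ₑ) +
              3 * (b * (ENNReal.ofReal ((1 + ‖η‖) ^ 2))⁻¹))) ξ +
          (Q ⋆ₗ (fun η => (∑ j, ‖a η j‖ₑ) + 3 * Ψ η)) ξ +
          ((fun η => (∑ j, ‖a η j‖ₑ) + 3 * Ψ' η) ⋆ₗ Q) ξ +
          ((fun η => ENNReal.ofReal ((1 + ‖η‖) ^ K) * (∑ j, ‖a η j‖ₑ) +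
              3 * (b * (ENNReal.ofReal ((1 + ‖η‖) ^ 2))⁻¹)) ⋆ₗ
            (fun η => (ENNReal.ofReal ((1 + ‖η‖) ^ K))⁻¹ * Q η)) ξ))) :=
  exp_weight_enorm_duhamelIntegral_hsub_sub_le' hc ha haw
    hEc.measurable (fun η => hEc.uncurry_right η) hEd hE'c.measurable (fun η => hE'c.uncurry_right η) hE'd K hlam hΨ hΨ' hB hB' hQ ht ξ

end HsubStep

/-! ### `L²` and pointwise bounds of the difference majorant -/

section DiffMajorant

variable {ι : Type*} [Fintype ι] {Q G₀ G₀' GK : EuclideanSpace ℝ ι → ℝ≥0∞}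

/-- `(a + b + c + d)² ≤ 4(a² + b² + c² + d²)` in `ℝ≥0∞`. [folklore] -/
theorem add_four_sq_le (a b c d : ℝ≥0∞) :
    (a + b + c + d) ^ 2 ≤ 4 * (a ^ 2 + b ^ 2 + c ^ 2 + d ^ 2) := by
  have hsq : ∀ x y : ℝ≥0∞, (x + y) ^ 2 ≤ 2 * x ^ 2 + 2 * y ^ 2 := fun x y => by
    have h := ENNReal.rpow_add_le_mul_rpow_add_rpow x y (p := 2) (by norm_num)
    norm_num at h
    rw [← mul_add]
    exact_mod_cast h
  calc (a + b + c + d) ^ 2 = ((a + b) + (c + d)) ^ 2 := by ring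
    _ ≤ 2 * (a + b) ^ 2 + 2 * (c + d) ^ 2 := hsq _ _
    _ ≤ 2 * (2 * a ^ 2 + 2 * b ^ 2) + 2 * (2 * c ^ 2 + 2 * d ^ 2) :=
        add_le_add (mul_le_mul' le_rfl (hsq _ _)) (mul_le_mul' le_rfl (hsq _ _))
    _ = _ := by ring

/-- **`L²` bound of the difference majorant** (Young four times, commutativity of `⋆ₗ`, and
Cauchy–Schwarz `(∫⁻ w^{-K}Q)² ≤ ∫⁻ w^{-2K} · ∫⁻ Q²`):

  `∫⁻ (μ·3((Q₀ ⋆ₗ G_K) + (Q ⋆ₗ G₀) + (G₀' ⋆ₗ Q) + (G_K ⋆ₗ Q₀)))²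
     ≤ μ² · 36 (2 W_K ∫⁻G_K² + (∫⁻G₀)² + (∫⁻G₀')²) ∫⁻ Q²`,

`Q₀ = (1+‖·‖)^{-K} Q`, `W_K = ∫⁻ (1+‖ξ‖)^{-2K}`. [folklore] -/
theorem lintegral_diff_majorant_sq_le (hQ : AEMeasurable Q volume) (hG₀ : AEMeasurable G₀ volume)
    (hG₀' : AEMeasurable G₀' volume) (hGK : AEMeasurable GK volume) (K : ℕ) (μ : ℝ≥0∞) :
    ∫⁻ ξ, (μ * (3 * (((fun η => (ENNReal.ofReal ((1 + ‖η‖) ^ K))⁻¹ * Q η) ⋆ₗ GK) ξ + (Q ⋆ₗ G₀) ξ +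
        (G₀' ⋆ₗ Q) ξ + (GK ⋆ₗ (fun η => (ENNReal.ofReal ((1 + ‖η‖) ^ K))⁻¹ * Q η)) ξ))) ^ 2 ≤
      μ ^ 2 * (36 * ((2 * ((∫⁻ ξ : EuclideanSpace ℝ ι, (ENNReal.ofReal ((1 + ‖ξ‖) ^ K))⁻¹ ^ 2) *
        ∫⁻ η, GK η ^ 2) + ((∫⁻ η, G₀ η) ^ 2 + (∫⁻ η, G₀' η) ^ 2)) * ∫⁻ η, Q η ^ 2)) := by
  set Q₀ : EuclideanSpace ℝ ι → ℝ≥0∞ := fun η => (ENNReal.ofReal ((1 + ‖η‖) ^ K))⁻¹ * Q η with hQ₀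
  set WK : ℝ≥0∞ := ∫⁻ ξ : EuclideanSpace ℝ ι, (ENNReal.ofReal ((1 + ‖ξ‖) ^ K))⁻¹ ^ 2 with hWK
  have hwm : AEMeasurable (fun η : EuclideanSpace ℝ ι => (ENNReal.ofReal ((1 + ‖η‖) ^ K))⁻¹) volume :=
    (measurable_ofReal_weight K).aemeasurable.inv
  have hQ₀m : AEMeasurable Q₀ volume := hwm.mul hQ
  -- the four Young bounds
  have hL1 : (∫⁻ η, Q₀ η) ^ 2 ≤ WK * ∫⁻ η, Q η ^ 2 := sq_lintegral_mul_le volume hwm hQ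
  have hY1 : ∫⁻ ξ, (Q₀ ⋆ₗ GK) ξ ^ 2 ≤ (WK * ∫⁻ η, Q η ^ 2) * ∫⁻ η, GK η ^ 2 := by
    rw [show (Q₀ ⋆ₗ GK) = (GK ⋆ₗ Q₀) from lconvolution_comm]
    exact (lintegral_lconv_sq_le hGK hQ₀m).trans (mul_le_mul' hL1 le_rfl)
  have hY2 : ∫⁻ ξ, (Q ⋆ₗ G₀) ξ ^ 2 ≤ (∫⁻ η, G₀ η) ^ 2 * ∫⁻ η, Q η ^ 2 := lintegral_lconv_sq_le hQ hG₀
  have hY3 : ∫⁻ ξ, (G₀' ⋆ₗ Q) ξ ^ 2 ≤ (∫⁻ η, G₀' η) ^ 2 * ∫⁻ η, Q η ^ 2 := by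
    rw [show (G₀' ⋆ₗ Q) = (Q ⋆ₗ G₀') from lconvolution_comm]
    exact lintegral_lconv_sq_le hQ hG₀'
  have hY4 : ∫⁻ ξ, (GK ⋆ₗ Q₀) ξ ^ 2 ≤ (WK * ∫⁻ η, Q η ^ 2) * ∫⁻ η, GK η ^ 2 :=
    (lintegral_lconv_sq_le hGK hQ₀m).trans (mul_le_mul' hL1 le_rfl)
  -- names for the scalar quantities
  set q2 := ∫⁻ η, Q η ^ 2 with hq2
  set k2 := ∫⁻ η, GK η ^ 2 with hk2
  set i₀ := ∫⁻ η, G₀ η with hi₀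
  set i₀' := ∫⁻ η, G₀' η with hi₀'
  -- measurability of the four squares
  have hm1 : AEMeasurable (fun ξ => (Q₀ ⋆ₗ GK) ξ ^ 2) volume := (aemeasurable_lconvolution hQ₀m hGK).pow_const 2
  have hm2 : AEMeasurable (fun ξ => (Q ⋆ₗ G₀) ξ ^ 2) volume := (aemeasurable_lconvolution hQ hG₀).pow_const 2
  have hm3 : AEMeasurable (fun ξ => (G₀' ⋆ₗ Q) ξ ^ 2) volume := (aemeasurable_lconvolution hG₀' hQ).pow_const 2
  have hm4 : AEMeasurable (fun ξ => (GK ⋆ₗ Q₀) ξ ^ 2) volume := (aemeasurable_lconvolution hGK hQ₀m).pow_const 2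
  have hsplit : ∫⁻ ξ, ((Q₀ ⋆ₗ GK) ξ ^ 2 + (Q ⋆ₗ G₀) ξ ^ 2 + (G₀' ⋆ₗ Q) ξ ^ 2 + (GK ⋆ₗ Q₀) ξ ^ 2) =
      (∫⁻ ξ, (Q₀ ⋆ₗ GK) ξ ^ 2) + (∫⁻ ξ, (Q ⋆ₗ G₀) ξ ^ 2) + (∫⁻ ξ, (G₀' ⋆ₗ Q) ξ ^ 2) +
        ∫⁻ ξ, (GK ⋆ₗ Q₀) ξ ^ 2 := by
    rw [lintegral_add_left' (f := fun ξ => (Q₀ ⋆ₗ GK) ξ ^ 2 + (Q ⋆ₗ G₀) ξ ^ 2 + (G₀' ⋆ₗ Q) ξ ^ 2)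
        ((hm1.add hm2).add hm3),
      lintegral_add_left' (f := fun ξ => (Q₀ ⋆ₗ GK) ξ ^ 2 + (Q ⋆ₗ G₀) ξ ^ 2) (hm1.add hm2),
      lintegral_add_left' (f := fun ξ => (Q₀ ⋆ₗ GK) ξ ^ 2) hm1]
  calc ∫⁻ ξ, (μ * (3 * ((Q₀ ⋆ₗ GK) ξ + (Q ⋆ₗ G₀) ξ + (G₀' ⋆ₗ Q) ξ + (GK ⋆ₗ Q₀) ξ))) ^ 2
      ≤ ∫⁻ ξ, (μ ^ 2 * 36) * ((Q₀ ⋆ₗ GK) ξ ^ 2 + (Q ⋆ₗ G₀) ξ ^ 2 + (G₀' ⋆ₗ Q) ξ ^ 2 +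
          (GK ⋆ₗ Q₀) ξ ^ 2) := by
        refine lintegral_mono fun ξ => ?_
        rw [mul_pow, mul_pow]
        calc μ ^ 2 * (3 ^ 2 * ((Q₀ ⋆ₗ GK) ξ + (Q ⋆ₗ G₀) ξ + (G₀' ⋆ₗ Q) ξ + (GK ⋆ₗ Q₀) ξ) ^ 2)
            ≤ μ ^ 2 * (3 ^ 2 * (4 * ((Q₀ ⋆ₗ GK) ξ ^ 2 + (Q ⋆ₗ G₀) ξ ^ 2 + (G₀' ⋆ₗ Q) ξ ^ 2 +
                (GK ⋆ₗ Q₀) ξ ^ 2))) :=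
              mul_le_mul' le_rfl (mul_le_mul' le_rfl (add_four_sq_le _ _ _ _))
          _ = _ := by ring
    _ = (μ ^ 2 * 36) * ((∫⁻ ξ, (Q₀ ⋆ₗ GK) ξ ^ 2) + (∫⁻ ξ, (Q ⋆ₗ G₀) ξ ^ 2) + (∫⁻ ξ, (G₀' ⋆ₗ Q) ξ ^ 2) +
          ∫⁻ ξ, (GK ⋆ₗ Q₀) ξ ^ 2) := by
        rw [lintegral_const_mul'' (f := fun ξ => (Q₀ ⋆ₗ GK) ξ ^ 2 + (Q ⋆ₗ G₀) ξ ^ 2 + (G₀' ⋆ₗ Q) ξ ^ 2 +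
          (GK ⋆ₗ Q₀) ξ ^ 2) _ (((hm1.add hm2).add hm3).add hm4), hsplit]
    _ ≤ (μ ^ 2 * 36) * ((WK * q2) * k2 + i₀ ^ 2 * q2 + i₀' ^ 2 * q2 + (WK * q2) * k2) := by
        gcongr
    _ = _ := by ring

/-- **Pointwise bound of the difference majorant** (Cauchy–Schwarz four times and
`‖(1+‖·‖)^{-K}Q‖₂ ≤ ‖Q‖₂`):
`μ·3((Q₀ ⋆ₗ G_K) + (Q ⋆ₗ G₀) + (G₀' ⋆ₗ Q) + (G_K ⋆ₗ Q₀))(ξ)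
   ≤ μ·3 (2‖G_K‖₂ + ‖G₀‖₂ + ‖G₀'‖₂) ‖Q‖₂`. [folklore] -/
theorem diff_majorant_le (hQ : AEMeasurable Q volume) (hG₀ : AEMeasurable G₀ volume)
    (hG₀' : AEMeasurable G₀' volume) (hGK : AEMeasurable GK volume) (K : ℕ) (μ : ℝ≥0∞)
    (ξ : EuclideanSpace ℝ ι) :
    μ * (3 * (((fun η => (ENNReal.ofReal ((1 + ‖η‖) ^ K))⁻¹ * Q η) ⋆ₗ GK) ξ + (Q ⋆ₗ G₀) ξ +
        (G₀' ⋆ₗ Q) ξ + (GK ⋆ₗ (fun η => (ENNReal.ofReal ((1 + ‖η‖) ^ K))⁻¹ * Q η)) ξ)) ≤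
      μ * (3 * ((2 * (∫⁻ η, GK η ^ 2) ^ (1 / 2 : ℝ) + (∫⁻ η, G₀ η ^ 2) ^ (1 / 2 : ℝ) +
        (∫⁻ η, G₀' η ^ 2) ^ (1 / 2 : ℝ)) * (∫⁻ η, Q η ^ 2) ^ (1 / 2 : ℝ))) := by
  set Q₀ : EuclideanSpace ℝ ι → ℝ≥0∞ := fun η => (ENNReal.ofReal ((1 + ‖η‖) ^ K))⁻¹ * Q η with hQ₀
  have hwm : AEMeasurable (fun η : EuclideanSpace ℝ ι => (ENNReal.ofReal ((1 + ‖η‖) ^ K))⁻¹) volume :=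
    (measurable_ofReal_weight K).aemeasurable.inv
  have hQ₀m : AEMeasurable Q₀ volume := hwm.mul hQ
  have hQ₀le : (∫⁻ η, Q₀ η ^ 2) ^ (1 / 2 : ℝ) ≤ (∫⁻ η, Q η ^ 2) ^ (1 / 2 : ℝ) := by
    refine ENNReal.rpow_le_rpow (lintegral_mono fun η => pow_le_pow_left' ?_ 2) (by norm_num)
    calc Q₀ η = (ENNReal.ofReal ((1 + ‖η‖) ^ K))⁻¹ * Q η := rfl
      _ ≤ 1 * Q η := mul_le_mul' (ENNReal.inv_le_one.2 (one_le_ofReal_weight K η)) le_rfl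
      _ = Q η := one_mul _
  set q := (∫⁻ η, Q η ^ 2) ^ (1 / 2 : ℝ) with hq
  set g := (∫⁻ η, GK η ^ 2) ^ (1 / 2 : ℝ) with hg
  set g₀ := (∫⁻ η, G₀ η ^ 2) ^ (1 / 2 : ℝ) with hg₀
  set g₀' := (∫⁻ η, G₀' η ^ 2) ^ (1 / 2 : ℝ) with hg₀'
  have h1 : (Q₀ ⋆ₗ GK) ξ ≤ q * g := (lconv_le_sqrt_mul_sqrt hQ₀m hGK ξ).trans (mul_le_mul' hQ₀le le_rfl)
  have h2 : (Q ⋆ₗ G₀) ξ ≤ q * g₀ := lconv_le_sqrt_mul_sqrt hQ hG₀ ξ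
  have h3 : (G₀' ⋆ₗ Q) ξ ≤ g₀' * q := lconv_le_sqrt_mul_sqrt hG₀' hQ ξ
  have h4 : (GK ⋆ₗ Q₀) ξ ≤ g * q := (lconv_le_sqrt_mul_sqrt hGK hQ₀m ξ).trans (mul_le_mul' le_rfl hQ₀le)
  calc μ * (3 * ((Q₀ ⋆ₗ GK) ξ + (Q ⋆ₗ G₀) ξ + (G₀' ⋆ₗ Q) ξ + (GK ⋆ₗ Q₀) ξ))
      ≤ μ * (3 * (q * g + q * g₀ + g₀' * q + g * q)) :=
        mul_le_mul' le_rfl (mul_le_mul' le_rfl (add_le_add (add_le_add (add_le_add h1 h2) h3) h4))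
    _ = _ := by ring

end DiffMajorant

end Literature.Analysis.FluidPDE.FourierNS

end
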